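import Summits.CriticalPhenomena.PercolationContinuityZ3.Theorems.PercNearOneGluingNoHeavyLowerTailSahiGridPatternOrthant

/-!
# `NoHeavyLowerTail` (crux stmt-CriticalPhenomena-4575), Sahi programme: **SAHI'S `C₃` WITH ONE ORTHANT SLOT ON EVERY GRID,
# EVERY PRODUCT WEIGHT, EVERY DIMENSION** (localisation of `sStarD_principal_nonneg`)

Support file (seat `prim-sahi-p1`, generation 9; `--supports stmt-CriticalPhenomena-4575`).  Pure proofs, no definitions, no `sorry`,
standard axioms.  Vocabulary of `…SahiGridPattern` (`Xd`, `Ssym`, `Tmap`, `pb`, `latticeE3_symm`) and `…SahiGridPatternOrthant`.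

* `sStarD_empty_left`, `Ssym_nonneg_orthant`: the pull-back of a grid ORTHANT `{x : q ≤ x} ⊆ [K+1]^d` along a sorted three-point
  sample is either empty or a principal filter of `[3]^d`, so its symmetrised pattern value is `≥ 0` by `sStarD_principal_nonneg`.
* `latticeE3_gridProd_nonneg_orthant` (every `d`, `K`): for every nonnegative product weight `w = ⊗_a g_a` on the grid `[K+1]^d`, every
  orthant `A = {x : q ≤ x}` and ALL up-sets `B, C`:  `0 ≤ latticeE3 w A B C`
  (`= Z³·E₃(1_A,1_B,1_C)`: `2Z²m(ABC) + m(A)m(B)m(C) − Z[m(A)m(BC) + m(B)m(AC) + m(C)m(AB)] ≥ 0`).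
* `sahiE_three_orthant_nonneg`: the same for a product PROBABILITY weight in Sahi's normalisation, `0 ≤ E₃(1_A,1_B,1_C)`.
* `sStarD_nonneg_liftTop_of_good`, `sStarD_nonneg_liftTwo_of_good`: the class of 'good first slots' `{D : sStarD D U V ≥ 0 ∀ up-sets U V}` is
  closed under `D ↦ D × {2}` and `D ↦ D × {1,2}` (every `n`).
This is Sahi's conjecture `C₃` (Sahi 2008 Conj. 5 at `n = 3`; Kahn's Conjecture 5 on grids) when one of the three increasing events is an
orthant (rectangle) and the other two are arbitrary, for every product measure on every finite grid — the coefficientwise/pattern form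
being `sStarD_principal_nonneg`.  ATTRIBUTION / PRECEDENT: at the level of a FIXED weight the statement (one principal slot, the other two
arbitrary up-sets, every nonnegative log-supermodular — in particular every product — weight on any finite distributive lattice) is already in the
tree as `Literature.Probability.LatticeModels.latticeE3_nonneg_of_principal` (Sahi 2008, Thm. 2 for product measures; Blinovsky 2013 for FKG
measures); what is NEW here is only the COEFFICIENTWISE form — nonnegativity of every coefficient of `Z³E₃` in the chain weights, i.e. the
pattern inequality with an orthant slot on `[3]^d` — of which the fixed-weight inequality is the evaluation at a nonnegative point.
(Lieb–Sahi 2022 have all three slots of rectangle type; the percolation-side `sahiE3_cylinder_nonneg` has one cylinder slot on Boolean cubes at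
the measure level; the present route is the pattern functional.) [this work]
-/

namespace Summit.CriticalPhenomena.PercolationContinuityZ3.Theorems.SahiGridPattern

open Finset Literature.Probability.LatticeModels Literature.Combinatorics.Sahi2008
open SahiGrid3 (ind)
open scoped BigOperators

variable {d K : ℕ}

/-- `sStarD` vanishes when the first set is empty. [this work] -/
theorem sStarD_empty_left (B C : Finset (Pd d)) : sStarD (∅ : Finset (Pd d)) B C = 0 := by
  rw [sStarD_eq_sum_tcD, Finset.sum_empty]

/-- Thresholds: for a monotone triple `v₀ ≤ v₁ ≤ v₂` and `x ≤ v₂`, the set `{c : x ≤ v_c}` is an upper interval `{c : t ≤ c}` of `[3]`. [this work] -/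
theorem threshold_three {α : Type*} [Preorder α] (v : Fin 3 → α) (hv : Monotone v) (x : α) (h2 : x ≤ v 2) :
    ∃ t : Fin 3, ∀ c : Fin 3, (x ≤ v c ↔ t ≤ c) := by
  by_cases h0 : x ≤ v 0
  · exact ⟨0, fun c => ⟨fun _ => Fin.zero_le _, fun _ => le_trans h0 (hv (Fin.zero_le _))⟩⟩
  by_cases h1 : x ≤ v 1
  · refine ⟨1, fun c => ?_⟩
    fin_cases c
    · exact iff_of_false h0 (by decide)
    · exact iff_of_true h1 (by decide)
    · exact iff_of_true h2 (by decide)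
  · refine ⟨2, fun c => ?_⟩
    fin_cases c
    · exact iff_of_false h0 (by decide)
    · exact iff_of_false h1 (by decide)
    · exact iff_of_true h2 (by decide)

/-- **The symmetrised pattern value of (orthant, up-set, up-set) is nonnegative** at every three-point sample `ω` of the grid: after
sorting, the orthant pulls back to a principal filter of `[3]^d` (or to the empty set). [this work] -/
theorem Ssym_nonneg_orthant (q : Xd d K) {B C : Finset (Xd d K)} (hB : IsUpperSet (B : Set (Xd d K)))
    (hC : IsUpperSet (C : Set (Xd d K))) (ω : Fin 3 → Xd d K) :
    0 ≤ Ssym (univ.filter fun x : Xd d K => ∀ a, q a ≤ x a) B C ω := by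
  set A : Finset (Xd d K) := univ.filter fun x : Xd d K => ∀ a, q a ≤ x a with hAdef
  let σ : Fin d → Equiv.Perm (Fin 3) := fun a => Tuple.sort fun c => ω c a
  have hsort : ∀ a, Monotone fun c => Tmap σ ω c a := fun a => by
    show Monotone ((fun c => ω c a) ∘ σ a)
    exact Tuple.monotone_sort _
  rw [← S_Tmap A B C σ ω, S_eq_sStarD]
  set ω' : Fin 3 → Xd d K := Tmap σ ω with hω'
  have mem_pb : ∀ p : Pd d, p ∈ pb ω' A ↔ ∀ a, q a ≤ ω' (p a) a := by
    intro p; unfold pb; rw [Finset.mem_filter, hAdef, Finset.mem_filter]; simp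
  have l2 : ∀ i : Fin 3, i ≤ 2 := by decide
  by_cases htop : ∀ a, q a ≤ ω' 2 a
  · -- the pull-back is the principal filter of the threshold point `t`
    choose t ht using fun a => threshold_three (fun c => ω' c a) (hsort a) (q a) (htop a)
    have e : pb ω' A = univ.filter fun p : Pd d => ∀ a, t a ≤ p a := by
      ext p; rw [mem_pb, Finset.mem_filter]
      simp only [Finset.mem_univ, true_and]
      exact ⟨fun h a => (ht a (p a)).1 (h a), fun h a => (ht a (p a)).2 (h a)⟩
    rw [e]
    exact sStarD_principal_nonneg d t _ _ (isUpperSet_pb hsort hB) (isUpperSet_pb hsort hC)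
  · -- some axis threshold is never met: the pull-back is empty
    simp only [not_forall] at htop
    obtain ⟨a, ha⟩ := htop
    have e : pb ω' A = ∅ := by
      ext p; rw [mem_pb]
      simp only [Finset.notMem_empty, iff_false, not_forall]
      exact ⟨a, fun h => ha (le_trans h (hsort a (l2 (p a))))⟩
    rw [e, sStarD_empty_left]

/-- **SAHI'S `C₃` WITH ONE ORTHANT SLOT ON EVERY GRID, homogeneous form** (every `d`, `K`): for every nonnegative product weight on
`[K+1]^d`, every orthant `{x : q ≤ x}` and all up-sets `B, C`, `0 ≤ latticeE3 w {x : q ≤ x} B C` (`= Z³E₃`). [this work] -/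
theorem latticeE3_gridProd_nonneg_orthant (g : Fin d → Fin (K + 1) → ℝ) (hg : ∀ a u, 0 ≤ g a u) (q : Xd d K)
    {B C : Finset (Xd d K)} (hB : IsUpperSet (B : Set (Xd d K))) (hC : IsUpperSet (C : Set (Xd d K))) :
    0 ≤ latticeE3 (fun ω : Xd d K => ∏ a, g a (ω a)) (univ.filter fun x : Xd d K => ∀ a, q a ≤ x a) B C := by
  have hcard : (0 : ℝ) < Fintype.card (Fin d → Equiv.Perm (Fin 3)) := by exact_mod_cast Fintype.card_pos
  have h := latticeE3_symm g (univ.filter fun x : Xd d K => ∀ a, q a ≤ x a) B C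
  have hsum : 0 ≤ ∑ ω : Fin 3 → Xd d K, (∏ c, ∏ a, g a (ω c a)) *
      (Ssym (univ.filter fun x : Xd d K => ∀ a, q a ≤ x a) B C ω : ℝ) :=
    Finset.sum_nonneg fun ω _ => mul_nonneg (Finset.prod_nonneg fun c _ => Finset.prod_nonneg fun a _ => hg a _)
      (by exact_mod_cast Ssym_nonneg_orthant q hB hC ω)
  rw [← h] at hsum
  exact (mul_nonneg_iff_of_pos_left hcard).1 hsum

/-- **SAHI'S `C₃` WITH ONE ORTHANT SLOT ON EVERY GRID, probability form** (every `d`, `K`): for every product probability weight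
`w = ⊗ g_i` on `[K+1]^d`, every orthant `A = {x : q ≤ x}` and all up-sets `B, C`, Sahi's third-order functional of the indicators is
nonnegative: `0 ≤ E₃(1_A, 1_B, 1_C)`. [this work] -/
theorem sahiE_three_orthant_nonneg (g : Fin d → Fin (K + 1) → ℝ) (hg0 : ∀ i u, 0 ≤ g i u) (hg1 : ∀ i, ∑ u, g i u = 1)
    (q : Xd d K) {B C : Finset (Xd d K)} (hB : IsUpperSet (B : Set (Xd d K))) (hC : IsUpperSet (C : Set (Xd d K))) :
    0 ≤ sahiE (fun ω : Xd d K => ∏ i, g i (ω i)) 3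
      ![setInd (univ.filter fun x : Xd d K => ∀ a, q a ≤ x a), setInd B, setInd C] := by
  classical
  have hsum : ∑ ω : Fin d → Fin (K + 1), ∏ i, g i (ω i) = 1 := by
    rw [← Fintype.prod_sum]; simp [hg1]
  rw [sahiE_three_indicator_eq_latticeE3 hsum]
  exact latticeE3_gridProd_nonneg_orthant g hg0 q hB hC

/-! ### Closure of the good first slots under the two one-dimensional lifts -/

/-- **Top-only lift of a good slot** (every `n`): if `D ⊆ [3]^n` satisfies `sStarD D U V ≥ 0` for all up-sets `U, V`, then so does
`A = D × {2} ⊆ [3]^{n+1}` (slices `(∅, ∅, D)`), for all up-sets `B, C ⊆ [3]^{n+1}`. [this work] -/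
theorem sStarD_nonneg_liftTop_of_good {n : ℕ} {D : Finset (Pd n)}
    (hD : ∀ U V : Finset (Pd n), IsUpperSet (U : Set (Pd n)) → IsUpperSet (V : Set (Pd n)) → 0 ≤ sStarD D U V)
    (A B C : Finset (Pd (n + 1))) (hA : IsUpperSet (A : Set (Pd (n + 1)))) (hB : IsUpperSet (B : Set (Pd (n + 1))))
    (hC : IsUpperSet (C : Set (Pd (n + 1)))) (hA0 : ∀ q : Pd n, (Fin.snoc q 0 : Pd (n + 1)) ∉ A)
    (hA1 : ∀ q : Pd n, (Fin.snoc q 1 : Pd (n + 1)) ∉ A) (hA2 : ∀ q : Pd n, (Fin.snoc q 2 : Pd (n + 1)) ∈ A ↔ q ∈ D) :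
    0 ≤ sStarD A B C := by
  have L := two_mul_sStarD_top_le_of_topOnly A B C hA hB hC hA0 hA1
  have e : (univ.filter fun q : Pd n => (Fin.snoc q 2 : Pd (n + 1)) ∈ A) = D := by
    ext q; simp [hA2]
  rw [e] at L
  have h := hD _ _ (isUpperSet_filter_snoc hB 2) (isUpperSet_filter_snoc hC 2)
  linarith

/-- **Two-level lift of a good slot** (every `n`): if `D ⊆ [3]^n` satisfies `sStarD D U V ≥ 0` for all up-sets `U, V`, then so does
`A = D × {1,2} ⊆ [3]^{n+1}` (slices `(∅, D, D)`), for all up-sets `B, C ⊆ [3]^{n+1}`.  With `sStarD_nonneg_liftTop_of_good` and the axis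
symmetries this makes the class of 'good first slots' closed under products with the one-dimensional up-sets `{2}` and `{1,2}`; the
cylinder `D × [3]` is NOT covered (conjecturally `sStarD (D×[3]) B C ≥ Σ_k sStarD D B_k C_k + sStarD D B₂ C₂`, no instance-blind certificate
known). [this work] -/
theorem sStarD_nonneg_liftTwo_of_good {n : ℕ} {D : Finset (Pd n)}
    (hD : ∀ U V : Finset (Pd n), IsUpperSet (U : Set (Pd n)) → IsUpperSet (V : Set (Pd n)) → 0 ≤ sStarD D U V)
    (A B C : Finset (Pd (n + 1))) (hA : IsUpperSet (A : Set (Pd (n + 1)))) (hB : IsUpperSet (B : Set (Pd (n + 1))))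
    (hC : IsUpperSet (C : Set (Pd (n + 1)))) (hA0 : ∀ q : Pd n, (Fin.snoc q 0 : Pd (n + 1)) ∉ A)
    (hA1 : ∀ q : Pd n, (Fin.snoc q 1 : Pd (n + 1)) ∈ A ↔ q ∈ D) (hA2 : ∀ q : Pd n, (Fin.snoc q 2 : Pd (n + 1)) ∈ A ↔ q ∈ D) :
    0 ≤ sStarD A B C := by
  have hA12 : ∀ q : Pd n, (Fin.snoc q 1 : Pd (n + 1)) ∈ A ↔ (Fin.snoc q 2 : Pd (n + 1)) ∈ A := fun q => by rw [hA1, hA2]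
  have L := sum_sStarD_le_of_liftTwo A B C hA hB hC hA0 hA12
  have e : (univ.filter fun q : Pd n => (Fin.snoc q 2 : Pd (n + 1)) ∈ A) = D := by
    ext q; simp [hA2]
  rw [e] at L
  have h11 := hD _ _ (isUpperSet_filter_snoc hB 1) (isUpperSet_filter_snoc hC 1)
  have h12 := hD _ _ (isUpperSet_filter_snoc hB 1) (isUpperSet_filter_snoc hC 2)
  have h21 := hD _ _ (isUpperSet_filter_snoc hB 2) (isUpperSet_filter_snoc hC 1)
  have h22 := hD _ _ (isUpperSet_filter_snoc hB 2) (isUpperSet_filter_snoc hC 2)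
  linarith

end Summit.CriticalPhenomena.PercolationContinuityZ3.Theorems.SahiGridPattern
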